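import Summits.FinalStateConjecture.FinalStateConjecture.Theorems.EIHFluxBalanceInertialRecessionStubSlavingZeroSet
import Literature.Geometry.Lorentzian.KerrRicciFlat

/-!
# Route EIHFluxBalance — `InertialRecession`, line `sublinear-is-free-clean-window-charges`:
# the zero set of the slaving map, ALL SPINS (for the slaving stub `stub_slaving`)

Helper file for the crux `stmt-FinalStateConjecture-10166`
(`Summit.FinalStateConjecture.FinalStateConjecture.Theses.EIHFluxBalance.InertialRecession`),
stub `stub_slaving`. The companion file `…StubSlavingZeroSet` proved that a painted SCHWARZSCHILD
summand with constant Lorentz map and inertial centre has vanishing coordinate Ricci form, and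
recorded the rotating case `a ≠ 0` as missing (fact "F1" of the slaving analysis: Ricci-flatness
of the Kerr–Schild datum for `a ≠ 0`). That fact is the theorem `Kerr.ricci_smoothMetric` of
`Literature.Geometry.Lorentzian.KerrRicciFlat` (Kerr 1963; Kerr–Schild 1965, §3), for every real
`M, a, r₀`; this file draws the three consequences for all spins:

* `ricAt_kerr_bilin` — **`ricAt (g_{M,a}) x = 0`** wherever `r_a(x) > 0`, the coordinate form
  (`OpensChart.ricci_eq_ricAt` on the open submanifold `Kerr.region a 0`);
* `ricAt_boostedKerrBilin` — **every stationary painted Kerr summand is Ricci-flat in the lab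
  chart** (`ricAt_pullMetric` of `…StubSlavingHelpers` along the affine change of coordinates
  `x ↦ Λ⁻¹(x − c)`, `pullMetric_kerr_bilin_poincareInv`);
* `ricAt_inertialSummand` — **so is the crux's summand painted with CONSTANT `Λ` and the
  INERTIAL centre `ξ(s) = ξ₀ + (s − s₀) v(Λ)`**, `v(Λ) = (Λe₀)~/(Λe₀)⁰`
  (`boostedKerrBilin_inertialCentre`): zero slaving error ⇒ `Ric = 0`, for every spin.
-/

set_option linter.dupNamespace false
set_option maxSynthPendingDepth 3

noncomputable section

open scoped Topology Manifold ContDiff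
open Filter Set Function TopologicalSpace Literature.Geometry.Lorentzian
  Summit.FinalStateConjecture.FinalStateConjecture.Theorems

namespace Summit.FinalStateConjecture.FinalStateConjecture.Theorems.SublinearIsFree.Slaving

/-- **The Kerr–Schild components have vanishing coordinate Ricci form, for every spin**:
`ricAt (g_{M,a}) x = 0` wherever `r_a(x) > 0` (Kerr 1963; Kerr–Schild 1965, §3, through
`Kerr.ricci_smoothMetric` and `OpensChart.ricci_eq_ricAt`). [folklore] -/
theorem ricAt_kerr_bilin (M a : ℝ) {x : E4} (hx : 0 < Kerr.radius a x) (Y Z : E4) :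
    MetricCoord.ricAt (Kerr.bilin M a) x Y Z = 0 := by
  haveI : Kerr.Facts :=
    ⟨Kerr.isConnected_region_holds, Kerr.contMDiff_bilin_holds, Kerr.contMDiff_timeVector_holds⟩
  have hx' : x ∈ Kerr.region a 0 := by
    rw [Kerr.mem_region, max_self]
    exact hx
  haveI := (Kerr.smoothMetric M a 0).toPseudoRiemannianMetric.hasLeviCivita
  have h1 := OpensChart.ricci_eq_ricAt (g := (Kerr.smoothMetric M a 0).toPseudoRiemannianMetric)
    (G := Kerr.bilin M a) (fun y ↦ Kerr.smoothMetric_val M a 0 y) ⟨x, hx'⟩ Y Z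
  rw [← h1]
  have h2 : (Kerr.smoothMetric M a 0).toPseudoRiemannianMetric.ricci ⟨x, hx'⟩ = 0 :=
    Kerr.ricci_smoothMetric M a 0 ⟨x, hx'⟩
  rw [h2]
  rfl

/-- **Every stationary painted Kerr summand is Ricci-flat in the lab chart, for every spin**:
`ricAt (boostedKerrBilin Λ c M a) x = 0` wherever the rest-frame radius is positive
(`ricAt_pullMetric` + `ricAt_kerr_bilin`; Kerr–Schild 1965, §3: Lorentz covariance of the
Kerr–Schild form). [folklore] -/
theorem ricAt_boostedKerrBilin (Λ : lorentzGroup) (c : E4) (M a : ℝ) {x : E4}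
    (hx : 0 < Kerr.radius a (poincareInv Λ c x)) (Y Z : E4) :
    MetricCoord.ricAt (boostedKerrBilin Λ c M a) x Y Z = 0 := by
  have hx' : x ∈ poincareInv Λ c ⁻¹' (Kerr.region a 0 : Set E4) := by
    show poincareInv Λ c x ∈ (Kerr.region a 0 : Set E4)
    rw [SetLike.mem_coe, Kerr.mem_region, max_self]
    exact hx
  rw [← pullMetric_kerr_bilin_poincareInv,
    ricAt_pullMetric (isMetricOn_kerr_bilin M a) (isCoordChangeOn_poincareInv Λ c a) hx' Y Z]
  exact ricAt_kerr_bilin M a hx _ _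

/-- **Zero slaving error ⇒ `Ric = 0`, for every spin.** The crux's summand painted with a
CONSTANT Lorentz map `Λ` and the INERTIAL centre `ξ(s) = ξ₀ + (s − s₀) v(Λ)`,
`v(Λ) = (Λe₀)~/(Λe₀)⁰` — i.e. with vanishing slaving jets `u̇ = 0`, `ξ̇ − v(Λ) = 0` — is, as a
field on `E4`, the stationary boosted Kerr–Schild field (`boostedKerrBilin_inertialCentre`) and
therefore has vanishing coordinate Ricci form wherever its painted radius is positive
(Kerr–Schild 1965, §§2–3). This is the exact zero set of the slaving mechanism. [folklore] -/
theorem ricAt_inertialSummand (Λ : lorentzGroup) (s₀ : ℝ) (ξ₀ : E3) (M a : ℝ) {x : E4}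
    (hx : 0 < Kerr.radius a (poincareInv Λ (E4.ofTimeSpace s₀ ξ₀) x)) (Y Z : E4) :
    MetricCoord.ricAt (fun y : E4 ↦ boostedKerrBilin Λ (E4.ofTimeSpace (y 0) (ξ₀ + (y 0 - s₀) •
      ((((Λ : E4 ≃L[ℝ] E4) (E4.basisVector 0)) 0)⁻¹ •
        E4.spatial ((Λ : E4 ≃L[ℝ] E4) (E4.basisVector 0))))) M a y) x Y Z = 0 := by
  have h : (fun y : E4 ↦ boostedKerrBilin Λ (E4.ofTimeSpace (y 0) (ξ₀ + (y 0 - s₀) •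
      ((((Λ : E4 ≃L[ℝ] E4) (E4.basisVector 0)) 0)⁻¹ •
        E4.spatial ((Λ : E4 ≃L[ℝ] E4) (E4.basisVector 0))))) M a y) =
      boostedKerrBilin Λ (E4.ofTimeSpace s₀ ξ₀) M a :=
    funext fun y ↦ boostedKerrBilin_inertialCentre Λ s₀ ξ₀ M a (y 0) y
  rw [h]
  exact ricAt_boostedKerrBilin Λ _ M a hx Y Z

/-- **Registered sub-goal form** (worker carrier `slaving_ricAt_inertialSummand` of the crux item)
of `ricAt_inertialSummand`: the crux's Kerr summand (any spin) painted with constant `Λ` and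
inertial centre is Ricci-flat in the lab chart. [folklore] -/
theorem slaving_ricAt_inertialSummand : open Literature.Geometry.Lorentzian in ∀ (Λ : lorentzGroup) (s₀ : ℝ) (ξ₀ : E3) (M a : ℝ) {x : E4}, 0 < Kerr.radius a (poincareInv Λ (E4.ofTimeSpace s₀ ξ₀) x) → ∀ (Y Z : E4), MetricCoord.ricAt (fun y : E4 ↦ boostedKerrBilin Λ (E4.ofTimeSpace (y 0) (ξ₀ + (y 0 - s₀) • ((((Λ : E4 ≃L[ℝ] E4) (E4.basisVector 0)) 0)⁻¹ • E4.spatial ((Λ : E4 ≃L[ℝ] E4) (E4.basisVector 0))))) M a y) x Y Z = 0 :=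
  fun Λ s₀ ξ₀ M a _ hx Y Z ↦ ricAt_inertialSummand Λ s₀ ξ₀ M a hx Y Z

end Summit.FinalStateConjecture.FinalStateConjecture.Theorems.SublinearIsFree.Slaving

end
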